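import Summits.AtomisticToContinuum.Crystallization.Theorems.PhononSlackCertificatesPeriodicGivenLayered
import Summits.AtomisticToContinuum.Crystallization.Theorems.ChargedEnergyGap.Negative.Unconditional

/-!
# Crux `TransitiveLocalLimit` (stmt-AtomisticToContinuum-15100), line `MotifTwo` — stub `stub_level`

The LEVEL of a transitive layered hull point is `2E*`. Let `x` be a sequence of Lennard-Jones ground states and
`S = A(S(a, s, z))` a layered set (`a ∈ [47/50, 1]`, Hägg word `s`, gaps in `[39a/50, 17a/20]`) lying in the hull
of `x` (two-way matched on every ball by translates of `x N`, frequently in `N`). If every site sum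
`Σ'_{q ∈ S, q ≠ p} V_LJ(|p − q|)` equals the same number `u`, then `u = 2E*`, `E* = ⨅_Q e_LJ(Q)`.

Proof. On the prism `W = W(0, K, K)` of `LayeredHull.cake_prisms` (`#W = K·K²`, boundary weight
`∂W ≤ 192 (K·K + K²)`) the site sums add up to `#W · u`; the landed window bounds of the 11779 line,
(U) `LayeredHull.wb_upper` (cut-and-paste in the finite ground states — needs the hull) and (L)
`LayeredHull.wb_lower` (needs only the `1/2`-separation `LayeredHull.cake_separated`), squeeze `#W · u` between
`2 E(#W) ∓ C ∂W`, so `|u − 2 E(K·K²)/(K·K²)| ≤ C'/K`; and `E(M)/M → E*` (`ChargedEnergyGapNegative.crysEnergyLimit`)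
along `M = K·K²`. No stacking selection and no identification of `E*` enter. [folklore]
-/

noncomputable section

namespace Summit.AtomisticToContinuum.Crystallization.Theorems.TransitiveLocalLimitMotifTwo

open Filter
open Literature.MathematicalPhysics.StatisticalMechanics
open Summit.AtomisticToContinuum.Crystallization.Theorems.LayeredHull

/-- A sum over a finite window of a function constant (`= u`) on a superset is `#W · u`. [folklore] -/
theorem lvl_sum_eq_card_mul {W : Finset (EuclideanSpace ℝ (Fin 3))} {S : Set (EuclideanSpace ℝ (Fin 3))}
    {f : EuclideanSpace ℝ (Fin 3) → ℝ} {u : ℝ} (hWS : (↑W : Set (EuclideanSpace ℝ (Fin 3))) ⊆ S)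
    (hu : ∀ p ∈ S, f p = u) : ∑ p ∈ W, f p = (W.card : ℝ) * u := by
  rw [Finset.sum_congr rfl fun p hp => hu p (hWS (Finset.mem_coe.2 hp)), Finset.sum_const, nsmul_eq_mul]

/-- Window-bound arithmetic: a two-sided bound `2E − C_L ∂ ≤ M u ≤ 2E + C_U ∂` with `0 ≤ ∂ ≤ B` gives
`|M u − 2E| ≤ (|C_U| + |C_L|) B`. [folklore] -/
theorem lvl_abs_le {Mu EM bd CU CL B : ℝ} (hUw : Mu ≤ 2 * EM + CU * bd) (hLw : 2 * EM - CL * bd ≤ Mu)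
    (hbd0 : 0 ≤ bd) (hbd : bd ≤ B) : |Mu - 2 * EM| ≤ (|CU| + |CL|) * B := by
  have h1 : CU * bd ≤ |CU| * B :=
    (le_abs_self _).trans (by rw [abs_mul, abs_of_nonneg hbd0]; exact mul_le_mul_of_nonneg_left hbd (abs_nonneg _))
  have h2 : CL * bd ≤ |CL| * B :=
    (le_abs_self _).trans (by rw [abs_mul, abs_of_nonneg hbd0]; exact mul_le_mul_of_nonneg_left hbd (abs_nonneg _))
  have hB : 0 ≤ B := hbd0.trans hbd
  rw [abs_le]
  constructor <;> nlinarith [abs_nonneg CU, abs_nonneg CL]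

/-- **STUB `stub_level` of line `MotifTwo`** (registered signature, verbatim): a layered set in the hull of a
Lennard-Jones ground-state sequence all of whose site sums equal `u` has `u = 2E*`. The layered set is the
named argument `S` with its defining equation `hS`. [folklore] -/
theorem stub_level : ∀ x : (N : ℕ) → (Fin N → EuclideanSpace ℝ (Fin 3)), (∀ N, IsGroundState lennardJones (x N)) → ∀ a : ℝ, 47 / 50 ≤ a → a ≤ 1 → ∀ (A : EuclideanSpace ℝ (Fin 3) →ₗᵢ[ℝ] EuclideanSpace ℝ (Fin 3)) (s : ℤ → ℤ) (z : ℤ → ℝ), IsHaggSeq s → (∀ m : ℤ, 39 / 50 * a ≤ z (m + 1) - z m ∧ z (m + 1) - z m ≤ 17 / 20 * a) → ∀ S : Set (EuclideanSpace ℝ (Fin 3)), S = {p : EuclideanSpace ℝ (Fin 3) | ∃ m i j : ℤ, p = A (((i : ℝ) • triangularVec₁ a) + ((j : ℝ) • triangularVec₂ a) + ((haggLabel s m : ℝ) • barlowOffset a) + (z m • layerNormal 1))} → (∀ R ε : ℝ, 0 < ε → ∃ᶠ N in atTop, ∃ t : EuclideanSpace ℝ (Fin 3), (∀ p ∈ S,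 ‖p‖ ≤ R → ∃ i : Fin N, dist (x N i + t) p ≤ ε) ∧ (∀ i : Fin N, ‖x N i + t‖ ≤ R → ∃ p ∈ S, dist (x N i + t) p ≤ ε)) → ∀ u : ℝ, (∀ p ∈ S, (∑' q : {q : EuclideanSpace ℝ (Fin 3) // q ∈ S ∧ q ≠ p}, lennardJones (dist p (q : EuclideanSpace ℝ (Fin 3)))) = u) → u = 2 * ⨅ Q : PeriodicConfiguration 3, Q.energyPerParticle lennardJones := by
  intro x hx a ha ha1 A s z _hs hz S hS hH u hu
  have hz1 : ∀ m : ℤ, 39 / 50 * a ≤ z (m + 1) - z m := fun m => (hz m).1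
  -- constants of the window bounds; separation of the layered set
  obtain ⟨CU, hU⟩ := stub_windowBounds.1
  obtain ⟨CL, hL⟩ := stub_windowBounds.2 (1 / 2) (by norm_num)
  have hsep : ∀ p ∈ S, ∀ q ∈ S, p ≠ q → 1 / 2 ≤ dist p q := by
    subst hS; exact cake_separated a ha A s z hz1
  -- the key estimate on the prisms `W(0, K, K)`
  have hkey : ∀ K : ℕ, 0 < K →
      |u - 2 * (groundStateEnergy lennardJones 3 (K * K ^ 2) / ((K * K ^ 2 : ℕ) : ℝ))| ≤
        2 * ((|CU| + |CL|) * 192) / K := by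
    intro K hK
    obtain ⟨hWsub, hWcard, -, hWbd⟩ := cake_prisms a ha ha1 A s z hz1 0 K K S hS _ rfl
    have hUw := hU x hx S hH _ hWsub
    have hLw := hL S hsep _ hWsub
    rw [lvl_sum_eq_card_mul hWsub hu, hWcard] at hUw hLw
    have habs := lvl_abs_le hUw hLw (Finset.sum_nonneg fun p _ =>
      pow_nonneg (inv_nonneg.2 (add_nonneg zero_le_one Metric.infDist_nonneg)) 3) hWbd
    -- divide by `M = K · K² > 0`
    have hKr : (0 : ℝ) < K := by exact_mod_cast hK
    have hM : (0 : ℝ) < ((K * K ^ 2 : ℕ) : ℝ) := by positivity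
    have e1 : u - 2 * (groundStateEnergy lennardJones 3 (K * K ^ 2) / ((K * K ^ 2 : ℕ) : ℝ)) =
        (((K * K ^ 2 : ℕ) : ℝ) * u - 2 * groundStateEnergy lennardJones 3 (K * K ^ 2)) /
          ((K * K ^ 2 : ℕ) : ℝ) := by
      field_simp
    rw [e1, abs_div, abs_of_pos hM, div_le_iff₀ hM]
    refine habs.trans (le_of_eq ?_)
    push_cast
    field_simp
    ring
  -- the limit `E(M)/M → E*` along `M = K · K²`
  have hφ : Tendsto (fun K : ℕ => K * K ^ 2) atTop atTop :=
    tendsto_atTop_mono (fun K => (Nat.le_self_pow three_ne_zero K).trans (le_of_eq (by ring))) tendsto_id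
  have hlim : Tendsto (fun K : ℕ => 2 * (groundStateEnergy lennardJones 3 (K * K ^ 2) / ((K * K ^ 2 : ℕ) : ℝ)))
      atTop (nhds (2 * ⨅ Q : PeriodicConfiguration 3, Q.energyPerParticle lennardJones)) :=
    (Summit.AtomisticToContinuum.Crystallization.Theorems.ChargedEnergyGapNegative.crysEnergyLimit.comp hφ).const_mul 2
  -- the same sequence tends to `u`
  have hlim' : Tendsto (fun K : ℕ => 2 * (groundStateEnergy lennardJones 3 (K * K ^ 2) / ((K * K ^ 2 : ℕ) : ℝ)))
      atTop (nhds u) := by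
    have h0 : Tendsto (fun K : ℕ => u - 2 * (groundStateEnergy lennardJones 3 (K * K ^ 2) /
        ((K * K ^ 2 : ℕ) : ℝ))) atTop (nhds 0) := by
      refine squeeze_zero_norm' (a := fun K : ℕ => 2 * ((|CU| + |CL|) * 192) / (K : ℝ)) ?_ ?_
      · filter_upwards [eventually_gt_atTop 0] with K hK
        rw [Real.norm_eq_abs]
        exact hkey K hK
      · exact tendsto_const_div_atTop_nhds_zero_nat _
    have h1 := (tendsto_const_nhds (x := u)).sub h0
    simp only [sub_sub_cancel, sub_zero] at h1
    exact h1
  exact tendsto_nhds_unique hlim' hlim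

end Summit.AtomisticToContinuum.Crystallization.Theorems.TransitiveLocalLimitMotifTwo

end
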